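import Summits.NavierStokesRegularity.NavierStokesRegularity.Theorems.TypeILiouvilleTypeIliouvilleNoTypeIIOfWindowActivity
import HarnessLib

/-!
# The Type-II zoom package (crux `TypeIliouvilleNoTypeII`, stmt-NavierStokesRegularity-0056)

Helper file (theorems only) for the shared hard core `NoTypeII` — every maximal smooth solution of
Navier–Stokes on `ℝ³ × [0, T)`, Leray–Hopf from a rapidly decaying datum, blows up at the sup-norm
Type-I rate `‖u(t)‖_∞ ≤ C (T - t)^{-1/2}` — and for the Type-II-exclusion estimate programme
(D-0081 §B) that attacks it.  Every argument of the form "an a-priori estimate `E` excludes Type-II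
blow-up" runs through the same blow-up dichotomy (Koch–Nadirashvili–Seregin–Šverák 2009 §6,
Giga–Miura 2011): if the sup-norm rate FAILS, zoom at the sup-norm near-maxima of long two-sided
sup-controlled windows (Poláčik–Quittner–Souplet time doubling) and pass to a bounded ETERNAL
Oseen-mild limit; the estimate `E` must then be transferred to the limit and a Liouville theorem
must kill it.  This file lands the UNCONDITIONAL half of that scheme once and for all, as a package
exporting the approximating windows together with the limit and the convergence, so that each
candidate estimate only has to supply its own transfer and rigidity steps:

* `exists_valueActiveWindow` — if `(u, p)` is maximal with lifespan `T`, Leray–Hopf from a rapidly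
  decaying datum and NOT Type I at `T`, then beyond every `a < T` and for every rescaled half-length
  `K` there is a two-sided window `[t - Kν/M², t + Kν/M²] ⊆ (a, T)`, `M = ‖u(t)‖_∞`, on which
  `‖u‖ ≤ 2M` (time doubling, landed `stub_timeDoubling`, fed by the sup-norm modulus `stub_supNorm`
  and `unbounded_of_not_isTypeIBlowup`) and whose centre is VALUE-active, `M ≤ 2‖u(t, x₀)‖`;
* `exists_typeIIZoomPackage` — the windows of half-length `j` inside the final slabs
  `(T - T/(j+1), T)`, their zooms `w_j(s, y) = M_j⁻¹ u(t_j + sν/M_j², x_j + yν/M_j)` (`‖w_j‖ ≤ 2`,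
  `‖w_j(0,0)‖ ≥ 1/2`), and — after the `C¹_loc` extraction of the landed
  `exists_tendsto_of_bounded_seq`, re-indexed so that no subsequence appears — a bounded eternal
  Oseen-mild smooth divergence-free limit `v` on `ℝ × ℝ³`, `‖v‖ ≤ 2`, `‖v(0,0)‖ ≥ 1/2`, with
  `w_j → v` and `∇w_j → ∇v` at every point of space-time;
* `exists_eternal_of_not_isTypeIBlowup` — the profile alone: Type-II blow-up of a maximal
  Leray–Hopf solution from rapidly decaying data generates a nonzero bounded eternal mild solution
  (`‖v‖ ≤ 2`, `v(0,0) ≠ 0`) — the conclusion of the registered stub `stub_eternalProfileOfTypeII`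
  of the line `Cruxes/TypeIliouvilleNoTypeII/Lines/eternal_split.lean` MINUS its pressure /
  `𝐈 < ∞` clauses, which are that stub's genuine content (inheritance of Albritton–Barker's
  quantity by the limit) and are NOT proved here;
* `isTypeIBlowup_of_transfer_of_rigidity` / `typeIliouvilleNoTypeII_of_transfer_of_rigidity` —
  the uniform composition, per solution (the shape of the door calculus' KILL obligation
  `frame ∧ D → IsTypeIBlowup u T`) and for the crux BY NAME: for any property `P` of eternal
  fields, TRANSFER (the package limit of a non-Type-I solution satisfies `P`) + RIGIDITY (bounded
  eternal mild fields with `P` vanish at the origin) ⇒ Type I.  A candidate estimate `E` of the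
  programme instantiates `P := E_∞` and owes exactly these two stubs.

What is deliberately NOT here: no Liouville theorem and no claim about the crux itself — the limit
`v` may be a constant flow (the death of the line `Sketch`: `Lines/Sketch_dead.md`), and excluding
that is exactly the job of the transferred estimate.  No pressure is constructed for `v`.
-/

noncomputable section

-- the summit and its single problem share the name `NavierStokesRegularity` (D-0017 nested layout)
set_option linter.dupNamespace false

open Set Function Filter Topology MeasureTheory Metric
open scoped NNReal ENNReal

namespace Summit.NavierStokesRegularity.NavierStokesRegularity.Theorems.TypeIliouvilleNoTypeII.TypeIIZoom

open Literature.Analysis Literature.Analysis.FluidPDE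
open Summit.NavierStokesRegularity.NavierStokesRegularity.Theorems.TypeIliouvilleNoTypeII.ImmortalZoom

variable {ν T M t₀ : ℝ} {u : ℝ → EuclideanSpace ℝ (Fin 3) → EuclideanSpace ℝ (Fin 3)}
  {p : ℝ → EuclideanSpace ℝ (Fin 3) → ℝ} {x₀ : EuclideanSpace ℝ (Fin 3)}

/-! ## Two elementary facts about the window zoom `w = M⁻¹ • stPull (ν/M²) (ν/M) t₀ x₀ u` -/

/-- **The bound of the window zoom, general level**: if `‖u‖ ≤ C·M` on the physical window
`[t₀ - kν/M², t₀ + kν/M²]` then `‖w‖ ≤ C` on the rescaled window `(-k, k)`. [folklore] -/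
theorem windowZoom_norm_le_of_le_mul (hν : 0 < ν) (hM : 0 < M) {k C : ℝ}
    (hbd : ∀ t ∈ Icc (t₀ - k * ν / M ^ 2) (t₀ + k * ν / M ^ 2), ∀ x, ‖u t x‖ ≤ C * M) {s : ℝ}
    (hs : s ∈ Ioo (-k) k) (y : EuclideanSpace ℝ (Fin 3)) :
    ‖(M⁻¹ • stPull (ν / M ^ 2) (ν / M) t₀ x₀ u) s y‖ ≤ C := by
  have hc : 0 < ν / M ^ 2 := by positivity
  have hmem : t₀ + ν / M ^ 2 * s ∈ Icc (t₀ - k * ν / M ^ 2) (t₀ + k * ν / M ^ 2) := by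
    refine ⟨?_, ?_⟩
    · have h := mul_lt_mul_of_pos_left hs.1 hc
      have e : ν / M ^ 2 * -k = -(k * ν / M ^ 2) := by ring
      linarith [e]
    · have h := mul_lt_mul_of_pos_left hs.2 hc
      have e : ν / M ^ 2 * k = k * ν / M ^ 2 := by ring
      linarith [e]
  rw [smul_stPull_apply, norm_smul, Real.norm_eq_abs, abs_of_pos (inv_pos.2 hM)]
  have h := hbd _ hmem (x₀ + (ν / M) • y)
  calc M⁻¹ * ‖u (t₀ + ν / M ^ 2 * s) (x₀ + (ν / M) • y)‖ ≤ M⁻¹ * (C * M) :=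
        mul_le_mul_of_nonneg_left h (inv_pos.2 hM).le
    _ = C := by field_simp

/-- **The value of the window zoom at the centre**: `‖w(0, 0)‖ = M⁻¹ ‖u(t₀, x₀)‖`. [folklore] -/
theorem norm_windowZoom_zero_zero (hM : 0 < M) :
    ‖(M⁻¹ • stPull (ν / M ^ 2) (ν / M) t₀ x₀ u) 0 0‖ = M⁻¹ * ‖u t₀ x₀‖ := by
  rw [smul_stPull_apply, mul_zero, add_zero, smul_zero, add_zero, norm_smul, Real.norm_eq_abs,
    abs_of_pos (inv_pos.2 hM)]

/-- **A value-active centre survives the zoom**: if `M ≤ 2‖u(t₀, x₀)‖` then `1/2 ≤ ‖w(0, 0)‖`.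
[folklore] -/
theorem half_le_norm_windowZoom_zero_zero (hM : 0 < M) (hact : M ≤ 2 * ‖u t₀ x₀‖) :
    1 / 2 ≤ ‖(M⁻¹ • stPull (ν / M ^ 2) (ν / M) t₀ x₀ u) 0 0‖ := by
  rw [norm_windowZoom_zero_zero hM]
  have h : M⁻¹ * M ≤ M⁻¹ * (2 * ‖u t₀ x₀‖) := mul_le_mul_of_nonneg_left hact (inv_pos.2 hM).le
  rw [inv_mul_cancel₀ hM.ne'] at h
  linarith

/-! ## Value-active two-sided windows from the failure of the Type-I rate -/

/-- **Value-active sup-controlled two-sided windows of a Type-II blow-up.**  Let `(u, p)` be a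
maximal smooth solution with lifespan `T`, Leray–Hopf from a rapidly decaying datum, which is NOT
Type I at `T`.  Then for every `K` and every `0 ≤ a < T` there are a time `t`, a level `M > 0` (the
sup norm `‖u(t)‖_∞`) and a point `x₀` such that the two-sided window `[t - Kν/M², t + Kν/M²]` lies in
`(a, T)`, `‖u‖ ≤ 2M` on it, and the centre is value-active: `M ≤ 2‖u(t, x₀)‖`.  (Poláčik–Quittner–
Souplet time doubling `stub_timeDoubling` applied to the sup-norm modulus of `stub_supNorm`, whose
product with `√(T - t)` is unbounded by `unbounded_of_not_isTypeIBlowup`.) [cite: KochNadirashviliSereginSverak2009, §6 proof of Prop. 6.1 (arXiv:0709.3599 p. 11)] -/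
theorem exists_valueActiveWindow (hν : 0 < ν) (hT : 0 < T)
    (hmax : IsMaximalSmoothSolution ν 0 u p T) (hLH : IsLerayHopfOn T ν 0 (u 0) u)
    (hdec : HasRapidSpatialDecay (u 0)) (hII : ¬ IsTypeIBlowup u T) (K : ℝ) {a : ℝ} (ha0 : 0 ≤ a)
    (haT : a < T) :
    ∃ t M : ℝ, ∃ x₀ : EuclideanSpace ℝ (Fin 3), 0 < M ∧
      Icc (t - K * ν / M ^ 2) (t + K * ν / M ^ 2) ⊆ Ioo a T ∧
      (∀ s ∈ Icc (t - K * ν / M ^ 2) (t + K * ν / M ^ 2), ∀ x, ‖u s x‖ ≤ 2 * M) ∧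
      M ≤ 2 * ‖u t x₀‖ := by
  obtain ⟨m, hmc, hle, hnear, c, hc, hler⟩ := stub_supNorm ν T hν hT u p hmax hLH hdec
  have hpos : ∀ t ∈ Ico 0 T, 0 < m t := fun t ht =>
    lt_of_lt_of_le (div_pos hc (Real.sqrt_pos.2 (by linarith [ht.2]))) (hler t ht)
  have hunb := unbounded_of_not_isTypeIBlowup hle hT hII
  -- restriction of the modulus to `[a, T)`
  have hmc' : ContinuousOn m (Ico a T) := hmc.mono (Ico_subset_Ico_left ha0)
  have hpos' : ∀ t ∈ Ico a T, 0 < m t := fun t ht => hpos t ⟨ha0.trans ht.1, ht.2⟩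
  have hunb' : ∀ K' : ℝ, ∀ t₁ < T, ∃ t ∈ Ico a T, t₁ < t ∧ K' < m t * Real.sqrt (T - t) := by
    intro K' t₁ ht₁
    obtain ⟨t, ht, h1, h2⟩ := hunb K' (max t₁ a) (max_lt ht₁ haT)
    exact ⟨t, ⟨((le_max_right _ _).trans_lt h1).le, ht.2⟩, (le_max_left _ _).trans_lt h1, h2⟩
  -- a doubling window of parameter `K' = max K 1 > 0` beyond `a`
  set K' : ℝ := max K 1 with hK'
  have hK'0 : 0 < K' := lt_of_lt_of_le one_pos (le_max_right _ _)
  have hKν : 0 < Real.sqrt (K' * ν) := Real.sqrt_pos.2 (mul_pos hK'0 hν)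
  obtain ⟨t, ht, -, -, hleft, hright, hdoub⟩ :=
    stub_timeDoubling (k := Real.sqrt (K' * ν)) hKν hmc' hpos' hunb' a haT
  have hMt : 0 < m t := hpos' t ht
  have hsq : Real.sqrt (K' * ν) ^ 2 = K' * ν := Real.sq_sqrt (mul_pos hK'0 hν).le
  rw [hsq] at hleft hright hdoub
  have ht0 : t ∈ Ico 0 T := ⟨ha0.trans ht.1, ht.2⟩
  obtain ⟨x₀, hx₀⟩ := hnear t ht0 (m t / 2) (by linarith)
  -- shrink from parameter `K'` to parameter `K ≤ K'`
  have hKK : K * ν / m t ^ 2 ≤ K' * ν / m t ^ 2 :=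
    div_le_div_of_nonneg_right (mul_le_mul_of_nonneg_right (le_max_left _ _) hν.le) (by positivity)
  have hbig : ∀ s ∈ Icc (t - K * ν / m t ^ 2) (t + K * ν / m t ^ 2),
      t - K' * ν / m t ^ 2 ≤ s ∧ s ≤ t + K' * ν / m t ^ 2 := fun s hs =>
    ⟨by linarith [hs.1], by linarith [hs.2]⟩
  refine ⟨t, m t, x₀, hMt, fun s hs => ?_, fun s hs x => ?_, by linarith⟩
  · obtain ⟨hs1, hs2⟩ := hbig s hs
    exact ⟨hleft.trans_le hs1, hs2.trans_lt hright⟩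
  · obtain ⟨hs1, hs2⟩ := hbig s hs
    have hsI : s ∈ Ico 0 T := ⟨ha0.trans (hleft.trans_le hs1).le, hs2.trans_lt hright⟩
    exact (hle s hsI x).trans (hdoub s ⟨hs1, hs2⟩)

/-! ## The package: windows, zooms, eternal limit, convergence -/

/-- **The Type-II zoom package.**  Let `(u, p)` be a maximal smooth solution of Navier–Stokes on
`ℝ³ × [0, T)`, Leray–Hopf from a rapidly decaying datum, which is NOT Type I at `T`.  Then there are
centres `(t_j, x_j)` and levels `M_j > 0`, `j : ℕ`, such that

* the two-sided window `[t_j - jν/M_j², t_j + jν/M_j²]` lies in the final slab `(T - T/(j+1), T)`,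
  `‖u‖ ≤ 2 M_j` on it, and `M_j ≤ 2‖u(t_j, x_j)‖`;
* the zooms `w_j(s, y) = M_j⁻¹ u(t_j + sν/M_j², x_j + yν/M_j)` (unit viscosity; `‖w_j‖ ≤ 2` on
  `(-j, j)`, `‖w_j(0,0)‖ ≥ 1/2`) converge at EVERY point of `ℝ × ℝ³`, together with their spatial
  gradients, to a field `v`;
* `v` is a bounded ETERNAL solution: jointly smooth on `ℝ × ℝ³`, divergence free, Oseen-mild
  between all pairs of times `s < t` (unit viscosity), `‖v‖ ≤ 2`, and `‖v(0, 0)‖ ≥ 1/2`.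

(Windows: `exists_valueActiveWindow`; zoom lemmas `windowZoom_*` and extraction
`exists_tendsto_of_bounded_seq` of the landed immortal-zoom files; the subsequence is re-indexed
away using `j ≤ φ j`.) [cite: KochNadirashviliSereginSverak2009, §6 Prop. 6.1 and Lemma 6.1 (arXiv:0709.3599 pp. 8, 11)] -/
theorem exists_typeIIZoomPackage (ν T : ℝ) (hν : 0 < ν) (hT : 0 < T)
    (u : ℝ → EuclideanSpace ℝ (Fin 3) → EuclideanSpace ℝ (Fin 3))
    (p : ℝ → EuclideanSpace ℝ (Fin 3) → ℝ)
    (hmax : IsMaximalSmoothSolution ν 0 u p T) (hLH : IsLerayHopfOn T ν 0 (u 0) u)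
    (hdec : HasRapidSpatialDecay (u 0)) (hII : ¬ IsTypeIBlowup u T) :
    ∃ (tc M : ℕ → ℝ) (xc : ℕ → EuclideanSpace ℝ (Fin 3))
      (v : ℝ → EuclideanSpace ℝ (Fin 3) → EuclideanSpace ℝ (Fin 3)),
      (∀ j, 0 < M j) ∧
      (∀ j : ℕ, Icc (tc j - j * ν / M j ^ 2) (tc j + j * ν / M j ^ 2) ⊆ Ioo (T - T / (j + 1)) T) ∧
      (∀ j : ℕ, ∀ s ∈ Icc (tc j - j * ν / M j ^ 2) (tc j + j * ν / M j ^ 2), ∀ x,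
        ‖u s x‖ ≤ 2 * M j) ∧
      (∀ j, M j ≤ 2 * ‖u (tc j) (xc j)‖) ∧
      ContDiff ℝ (⊤ : ℕ∞) (uncurry v) ∧ (∀ t, VectorCalculus.IsDivFree (v t)) ∧
      (∀ s t : ℝ, s < t → ∀ x, v t x = heatFlow (v s) (t - s) x - oseenDuhamel 1 s v v t x) ∧
      (∀ t x, ‖v t x‖ ≤ 2) ∧ 1 / 2 ≤ ‖v 0 0‖ ∧
      (∀ s y, Tendsto (fun j => ((M j)⁻¹ • stPull (ν / M j ^ 2) (ν / M j) (tc j) (xc j) u) s y)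
        atTop (𝓝 (v s y))) ∧
      (∀ s y, Tendsto
        (fun j => fderiv ℝ (((M j)⁻¹ • stPull (ν / M j ^ 2) (ν / M j) (tc j) (xc j) u) s) y)
        atTop (𝓝 (fderiv ℝ (v s) y))) := by
  have hsol : IsClassicalNSSolutionOn (Ico 0 T) ν 0 u p := hmax.1
  have hslab : ∀ k : ℕ, 0 ≤ T - T / (k + 1) ∧ T - T / (k + 1) < T := fun k => by
    have h1 : T / (k + 1) ≤ T := div_le_self hT.le (le_add_of_nonneg_left (Nat.cast_nonneg k))
    have h2 : 0 < T / (k + 1) := by positivity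
    exact ⟨by linarith, by linarith⟩
  -- Step 1: value-active windows of every half-length `k` in the final slabs `(T - T/(k+1), T)`
  have hwin : ∀ k : ℕ, ∃ t Mk : ℝ, ∃ x₀ : EuclideanSpace ℝ (Fin 3), 0 < Mk ∧
      Icc (t - k * ν / Mk ^ 2) (t + k * ν / Mk ^ 2) ⊆ Ioo (T - T / (k + 1)) T ∧
      (∀ s ∈ Icc (t - k * ν / Mk ^ 2) (t + k * ν / Mk ^ 2), ∀ x, ‖u s x‖ ≤ 2 * Mk) ∧
      Mk ≤ 2 * ‖u t x₀‖ := fun k =>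
    exists_valueActiveWindow hν hT hmax hLH hdec hII k (hslab k).1 (hslab k).2
  choose tc M xc hM hsub hbd hact using hwin
  have hsub0 : ∀ k : ℕ, Icc (tc k - k * ν / M k ^ 2) (tc k + k * ν / M k ^ 2) ⊆ Ioo 0 T := fun k =>
    (hsub k).trans (Ioo_subset_Ioo_left (hslab k).1)
  -- Step 2: the zooms and their `C¹_loc` extraction
  set w : ℕ → ℝ → EuclideanSpace ℝ (Fin 3) → EuclideanSpace ℝ (Fin 3) :=
    fun k => (M k)⁻¹ • stPull (ν / M k ^ 2) (ν / M k) (tc k) (xc k) u with hw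
  have hA : Tendsto (fun k : ℕ => -(k : ℝ)) atTop atBot :=
    tendsto_neg_atTop_atBot.comp tendsto_natCast_atTop_atTop
  have hB : Tendsto (fun k : ℕ => (k : ℝ)) atTop atTop := tendsto_natCast_atTop_atTop
  have hc : ∀ k : ℕ, ContinuousOn (uncurry (w k)) (Ioo (-(k : ℝ)) k ×ˢ univ) := fun k =>
    windowZoom_continuousOn hν hsol (hM k) (hsub0 k)
  have hdivw : ∀ k : ℕ, ∀ t ∈ Ioo (-(k : ℝ)) k, IsWeaklyDivFree (w k t) := fun k t ht =>
    windowZoom_isWeaklyDivFree hν hsol (hM k) (hsub0 k) ht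
  have hmild : ∀ k : ℕ, ∀ s t : ℝ, -(k : ℝ) < s → s < t → t < k → ∀ x,
      w k t x = UnboundedOperators.heatExtension (w k s) (t - s) x -
        oseenDuhamel 1 s (w k) (w k) t x := by
    intro k s t hs hst ht x
    have hsI : s ∈ Ioo (-(k : ℝ)) k := ⟨hs, hst.trans ht⟩
    have htI : t ∈ Ioo (-(k : ℝ)) k := ⟨hs.trans hst, ht⟩
    exact windowZoom_oseen hν hT hsol hLH hdec (hM k)
      (windowZoom_time_mem hν (hM k) (hsub0 k) hsI).1 hst
      (windowZoom_time_mem hν (hM k) (hsub0 k) htI).2 x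
  have hbdw : ∀ k : ℕ, ∀ t ∈ Ioo (-(k : ℝ)) k, ∀ x, ‖w k t x‖ ≤ 2 := fun k t ht x =>
    windowZoom_norm_le_of_le_mul hν (hM k) (hbd k) ht x
  obtain ⟨φ, hφ, W, hWs, hWdiv, hWmild, hWbd, hval, hgrad⟩ :=
    exists_tendsto_of_bounded_seq 2 hA hB hc hdivw hmild hbdw
  -- Step 3: re-index along `φ` (`j ≤ φ j`) and read off the package
  have hjφ : ∀ j : ℕ, (j : ℝ) ≤ φ j := fun j => by exact_mod_cast hφ.id_le j
  have hbig : ∀ j : ℕ, ∀ s ∈ Icc (tc (φ j) - j * ν / M (φ j) ^ 2) (tc (φ j) + j * ν / M (φ j) ^ 2),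
      s ∈ Icc (tc (φ j) - φ j * ν / M (φ j) ^ 2) (tc (φ j) + φ j * ν / M (φ j) ^ 2) := by
    intro j s hs
    have h1 : (j : ℝ) * ν / M (φ j) ^ 2 ≤ (φ j : ℝ) * ν / M (φ j) ^ 2 :=
      div_le_div_of_nonneg_right (mul_le_mul_of_nonneg_right (hjφ j) hν.le) (by positivity)
    exact ⟨by linarith [hs.1], by linarith [hs.2]⟩
  have hk0 : ∀ k, 1 / 2 ≤ ‖w k 0 0‖ := fun k => half_le_norm_windowZoom_zero_zero (hM k) (hact k)
  refine ⟨tc ∘ φ, M ∘ φ, xc ∘ φ, W, fun j => hM (φ j), fun j s hs => ?_, fun j s hs x => ?_,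
    fun j => hact (φ j), hWs, hWdiv, hWmild, hWbd, ?_, fun s y => ?_, fun s y => ?_⟩
  · -- the window of half-length `j` lies in the slab `(T - T/(j+1), T)`
    have h2 : T / ((φ j : ℝ) + 1) ≤ T / ((j : ℝ) + 1) :=
      div_le_div_of_nonneg_left hT.le (by positivity) (by linarith [hjφ j])
    have hs' := hsub (φ j) (hbig j s hs)
    exact ⟨by linarith [hs'.1], hs'.2⟩
  · exact hbd (φ j) s (hbig j s hs) x
  · exact ge_of_tendsto (hval 0 0).norm (Eventually.of_forall fun j => hk0 (φ j))
  · simpa only [hw, Function.comp_apply] using hval s y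
  · simpa only [hw, Function.comp_apply] using hgrad s y

/-- **Type-II blow-up generates a nonzero bounded eternal mild solution.**  If a maximal smooth
solution of Navier–Stokes on `ℝ³ × [0, T)`, Leray–Hopf from a rapidly decaying datum, is NOT Type I
at `T`, then there is a bounded eternal Oseen-mild solution `v` on `ℝ × ℝ³` — jointly smooth,
divergence free, `v(t) = e^{(t-s)Δ}v(s) - B¹_s(v,v)(t)` for all `s < t`, `‖v‖ ≤ 2` — with
`v(0, 0) ≠ 0`.  This is the velocity part of the conclusion of the registered stub
`stub_eternalProfileOfTypeII` (line `eternal_split`); the limit may be a constant flow. [cite: KochNadirashviliSereginSverak2009, §6 Prop. 6.1 (arXiv:0709.3599 p. 11)] -/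
theorem exists_eternal_of_not_isTypeIBlowup (ν T : ℝ) (hν : 0 < ν) (hT : 0 < T)
    (u : ℝ → EuclideanSpace ℝ (Fin 3) → EuclideanSpace ℝ (Fin 3))
    (p : ℝ → EuclideanSpace ℝ (Fin 3) → ℝ)
    (hmax : IsMaximalSmoothSolution ν 0 u p T) (hLH : IsLerayHopfOn T ν 0 (u 0) u)
    (hdec : HasRapidSpatialDecay (u 0)) (hII : ¬ IsTypeIBlowup u T) :
    ∃ v : ℝ → EuclideanSpace ℝ (Fin 3) → EuclideanSpace ℝ (Fin 3),
      ContDiff ℝ (⊤ : ℕ∞) (uncurry v) ∧ (∀ t, VectorCalculus.IsDivFree (v t)) ∧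
      (∀ s t : ℝ, s < t → ∀ x, v t x = heatFlow (v s) (t - s) x - oseenDuhamel 1 s v v t x) ∧
      (∀ t x, ‖v t x‖ ≤ 2) ∧ v 0 0 ≠ 0 := by
  obtain ⟨-, -, -, v, -, -, -, -, hv, hdiv, hmild, hbd, h0, -, -⟩ :=
    exists_typeIIZoomPackage ν T hν hT u p hmax hLH hdec hII
  refine ⟨v, hv, hdiv, hmild, hbd, fun h => ?_⟩
  rw [h, norm_zero] at h0
  linarith

/-! ## The uniform composition: transfer + rigidity ⇒ the Type-I rate / the crux -/

/-- **The Type-I rate of ONE solution from a transferred constraint and its rigidity** — the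
per-solution form, i.e. the shape of the KILL obligation `hkill : frame ∧ D → IsTypeIBlowup u T`
of the door calculus (`Theorems/TypeILiouvilleTypeIliouvilleNoTypeIIDoorCalculus.lean`).  Let `P` be
any property of eternal fields.  If for THIS maximal Leray–Hopf solution from a rapidly decaying
datum (TRANSFER) the failure of the Type-I rate forces the limit `v` of its Type-II zoom package to
satisfy `P`, and (RIGIDITY) every bounded eternal Oseen-mild smooth divergence-free field with
`‖v‖ ≤ 2` and `P v` vanishes at the origin, then the solution IS Type I at `T` (the package gives
`‖v(0,0)‖ ≥ 1/2`). [folklore] -/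
theorem isTypeIBlowup_of_transfer_of_rigidity
    (P : (ℝ → EuclideanSpace ℝ (Fin 3) → EuclideanSpace ℝ (Fin 3)) → Prop) (hν : 0 < ν) (hT : 0 < T)
    (hmax : IsMaximalSmoothSolution ν 0 u p T) (hLH : IsLerayHopfOn T ν 0 (u 0) u)
    (hdec : HasRapidSpatialDecay (u 0))
    (htransfer : ¬ IsTypeIBlowup u T →
      ∀ (tc M : ℕ → ℝ) (xc : ℕ → EuclideanSpace ℝ (Fin 3))
        (v : ℝ → EuclideanSpace ℝ (Fin 3) → EuclideanSpace ℝ (Fin 3)),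
        (∀ j, 0 < M j) →
        (∀ j : ℕ, Icc (tc j - j * ν / M j ^ 2) (tc j + j * ν / M j ^ 2) ⊆ Ioo (T - T / (j + 1)) T) →
        (∀ j : ℕ, ∀ s ∈ Icc (tc j - j * ν / M j ^ 2) (tc j + j * ν / M j ^ 2), ∀ x,
          ‖u s x‖ ≤ 2 * M j) →
        (∀ j, M j ≤ 2 * ‖u (tc j) (xc j)‖) →
        ContDiff ℝ (⊤ : ℕ∞) (uncurry v) → (∀ t, VectorCalculus.IsDivFree (v t)) →
        (∀ s t : ℝ, s < t → ∀ x, v t x = heatFlow (v s) (t - s) x - oseenDuhamel 1 s v v t x) →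
        (∀ t x, ‖v t x‖ ≤ 2) →
        (∀ s y, Tendsto (fun j => ((M j)⁻¹ • stPull (ν / M j ^ 2) (ν / M j) (tc j) (xc j) u) s y)
          atTop (𝓝 (v s y))) →
        (∀ s y, Tendsto
          (fun j => fderiv ℝ (((M j)⁻¹ • stPull (ν / M j ^ 2) (ν / M j) (tc j) (xc j) u) s) y)
          atTop (𝓝 (fderiv ℝ (v s) y))) →
        P v)
    (hrigid : ∀ v : ℝ → EuclideanSpace ℝ (Fin 3) → EuclideanSpace ℝ (Fin 3),
      ContDiff ℝ (⊤ : ℕ∞) (uncurry v) →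
      (∀ t, VectorCalculus.IsDivFree (v t)) →
      (∀ s t : ℝ, s < t → ∀ x, v t x = heatFlow (v s) (t - s) x - oseenDuhamel 1 s v v t x) →
      (∀ t x, ‖v t x‖ ≤ 2) → P v → v 0 0 = 0) :
    IsTypeIBlowup u T := by
  by_contra hII
  obtain ⟨tc, M, xc, v, hM, hsub, hbd, hact, hv, hdiv, hmild, hvbd, h0, hval, hgrad⟩ :=
    exists_typeIIZoomPackage ν T hν hT u p hmax hLH hdec hII
  have hP : P v := htransfer hII tc M xc v hM hsub hbd hact hv hdiv hmild hvbd hval hgrad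
  have h00 : v 0 0 = 0 := hrigid v hv hdiv hmild hvbd hP
  rw [h00, norm_zero] at h0
  linarith

/-- **The crux from a transferred constraint and its rigidity** (the uniform skeleton of the
Type-II-exclusion programme, concluded BY NAME).  Let `P` be any property of eternal fields.  If
(TRANSFER) for every maximal Leray–Hopf solution from rapidly decaying data which is not Type I,
the limit `v` of the Type-II zoom package satisfies `P` — this is where an a-priori estimate on `u`
and its scale invariance / lower semicontinuity enter — and (RIGIDITY) every bounded eternal
Oseen-mild smooth divergence-free field with `‖v‖ ≤ 2` and `P v` vanishes at the origin, then
`TypeIliouvilleNoTypeII` holds: `exists_typeIIZoomPackage` gives `‖v(0,0)‖ ≥ 1/2`, contradiction.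
Each candidate estimate `E` of the programme instantiates `P := E_∞` and owes exactly the two
hypotheses. [folklore] -/
theorem typeIliouvilleNoTypeII_of_transfer_of_rigidity
    (P : (ℝ → EuclideanSpace ℝ (Fin 3) → EuclideanSpace ℝ (Fin 3)) → Prop)
    (htransfer : ∀ (ν T : ℝ), 0 < ν → 0 < T →
      ∀ (u : ℝ → EuclideanSpace ℝ (Fin 3) → EuclideanSpace ℝ (Fin 3))
        (p : ℝ → EuclideanSpace ℝ (Fin 3) → ℝ),
      IsMaximalSmoothSolution ν 0 u p T → IsLerayHopfOn T ν 0 (u 0) u →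
      HasRapidSpatialDecay (u 0) → ¬ IsTypeIBlowup u T →
      ∀ (tc M : ℕ → ℝ) (xc : ℕ → EuclideanSpace ℝ (Fin 3))
        (v : ℝ → EuclideanSpace ℝ (Fin 3) → EuclideanSpace ℝ (Fin 3)),
        (∀ j, 0 < M j) →
        (∀ j : ℕ, Icc (tc j - j * ν / M j ^ 2) (tc j + j * ν / M j ^ 2) ⊆ Ioo (T - T / (j + 1)) T) →
        (∀ j : ℕ, ∀ s ∈ Icc (tc j - j * ν / M j ^ 2) (tc j + j * ν / M j ^ 2), ∀ x,
          ‖u s x‖ ≤ 2 * M j) →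
        (∀ j, M j ≤ 2 * ‖u (tc j) (xc j)‖) →
        ContDiff ℝ (⊤ : ℕ∞) (uncurry v) → (∀ t, VectorCalculus.IsDivFree (v t)) →
        (∀ s t : ℝ, s < t → ∀ x, v t x = heatFlow (v s) (t - s) x - oseenDuhamel 1 s v v t x) →
        (∀ t x, ‖v t x‖ ≤ 2) →
        (∀ s y, Tendsto (fun j => ((M j)⁻¹ • stPull (ν / M j ^ 2) (ν / M j) (tc j) (xc j) u) s y)
          atTop (𝓝 (v s y))) →
        (∀ s y, Tendsto
          (fun j => fderiv ℝ (((M j)⁻¹ • stPull (ν / M j ^ 2) (ν / M j) (tc j) (xc j) u) s) y)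
          atTop (𝓝 (fderiv ℝ (v s) y))) →
        P v)
    (hrigid : ∀ v : ℝ → EuclideanSpace ℝ (Fin 3) → EuclideanSpace ℝ (Fin 3),
      ContDiff ℝ (⊤ : ℕ∞) (uncurry v) →
      (∀ t, VectorCalculus.IsDivFree (v t)) →
      (∀ s t : ℝ, s < t → ∀ x, v t x = heatFlow (v s) (t - s) x - oseenDuhamel 1 s v v t x) →
      (∀ t x, ‖v t x‖ ≤ 2) → P v → v 0 0 = 0) :
    Summit.NavierStokesRegularity.NavierStokesRegularity.Theses.TypeILiouville.TypeIliouvilleNoTypeII :=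
  fun ν T hν hT u p hmax hLH hdec =>
    isTypeIBlowup_of_transfer_of_rigidity P hν hT hmax hLH hdec
      (htransfer ν T hν hT u p hmax hLH hdec) hrigid

end Summit.NavierStokesRegularity.NavierStokesRegularity.Theorems.TypeIliouvilleNoTypeII.TypeIIZoom

end
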